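import Literature.AlgebraicGeometry.Frobenioids.NumberFieldLocalizationCategories
import Literature.AlgebraicGeometry.Frobenioids.NumberFieldLocalizationCategoriesProofs
import Literature.AlgebraicGeometry.Frobenioids.BCatOrbits
import Mathlib.Data.Fintype.Card
import HarnessLib

/-!
# Frobenioids II, Example 1.4 (ii): the `Aut`-bijection holds over GALOIS objects (repaired form)

Mochizuki, *The geometry of Frobenioids II: poly-Frobenioids*, Kyushu J. Math. **62** (2008)
401–460, §1, Example 1.4 (ii), author's text p. 13 [cite: MochizukiFrdII2008, Ex. 1.4 (ii) p.13]:
"if `E₀ ∈ Ob(E₀)` projects to `P₀ ∈ Ob(P₀)`, then `E₀ → P₀` induces a bijection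
`Aut_{E₀}(E₀) ⥲ Aut_{P₀}(P₀)`".

The statement file types this AS PRINTED (`NFLocCat.AutBijective`, FLAG #10: the surjectivity half fails
at `(S₃, A₃)`, kernel witness `not_autBijective_perm_fin_three` of seat d9; injectivity
`autBijective_injective`, d9).  This PROOF-ONLY file supplies the antecedent-carrying REPAIRED form
suggested by the layer lead (flag protocol, item (3)): for an object `(P, Q, ι)` of `E₀` whose `Q`-part
is a GALOIS object of `B(G)` (all its points have the same stabiliser — `Q ≅ G/U` with `U` normal, i.e.
the finite extension `F'/F` is Galois), the map `Aut_{E₀}(P, Q, ι) → Aut_{P₀}(P)` IS bijective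
(`autBijective_of_galois`): an automorphism `α` of `P` lifts to the `G`-automorphism of `Q` sending
`ι(p₀) ↦ ι(α p₀)`, which exists because the two stabilisers coincide.  (At `(S₃, A₃)` the object
`Q = {0,1,2}` is not Galois.)  Recorded neutrally; no side is taken on the intended reading of print.
-/

namespace Literature.AlgebraicGeometry.Frobenioids

namespace NFLocCat

open CategoryTheory

universe u

variable {G : Type u} [Group G] [TopologicalSpace G]

/-- A transitive object of `B(G)` maps to any object through any point whose stabiliser contains the
stabiliser of the base point (`gx₀ ↦ gy`). [cite: MochizukiFrdI2008, §0 p.13] -/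
theorem exists_hom_of_stabilizer_le (X Y : BCat G) (x₀ : X.obj.V)
    (htr : ∀ x : X.obj.V, ∃ g : G, g • x₀ = x) (y : Y.obj.V)
    (hst : MulAction.stabilizer G x₀ ≤ MulAction.stabilizer G y) :
    ∃ f : X ⟶ Y, f.hom.hom x₀ = y := by
  classical
  choose c hc using htr
  have key : ∀ (g : G) (x : X.obj.V), c (g • x) • y = g • c x • y := by
    intro g x
    have e : c (g • x) • x₀ = (g * c x) • x₀ := by rw [hc, mul_smul, hc]
    have h1 : ((g * c x)⁻¹ * c (g • x)) • x₀ = x₀ := by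
      rw [mul_smul, e, ← mul_smul, inv_mul_cancel, one_smul]
    have h2 : ((g * c x)⁻¹ * c (g • x)) • y = y :=
      MulAction.mem_stabilizer_iff.mp (hst (MulAction.mem_stabilizer_iff.mpr h1))
    rw [mul_smul, inv_smul_eq_iff, mul_smul] at h2
    exact h2
  refine ⟨ObjectProperty.homMk
    { hom := FintypeCat.homMk fun x => c x • y
      comm := fun g => FintypeCat.hom_ext _ _ fun x => ?_ }, ?_⟩
  · change c (g • x) • y = g • (c x • y)
    exact key g x
  · change c x₀ • y = y
    exact MulAction.mem_stabilizer_iff.mp (hst (MulAction.mem_stabilizer_iff.mpr (hc x₀)))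

variable [IsTopologicalGroup G] (D : Subgroup G)

/-- For an object `(P, Q, ι)` of `E₀` with `Q` Galois, every automorphism `α` of `P` in `P₀` is the
`P`-component of a morphism `(P, Q, ι) → (P, Q, ι)` of `E₀` (lift `Q → Q`, `ι(p₀) ↦ ι(α p₀)`).
[cite: MochizukiFrdII2008, Ex. 1.4 (ii) p.13] -/
theorem exists_hom_of_left_galois (T : ECat G D)
    (hgal : ∀ q q' : T.obj.right.obj.obj.V, MulAction.stabilizer G q = MulAction.stabilizer G q')
    (α : (toP₀ G D).obj T ⟶ (toP₀ G D).obj T) : ∃ a : T ⟶ T, (toP₀ G D).map a = α := by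
  obtain ⟨p₀⟩ := nonempty_left D T
  let q₀ : T.obj.right.obj.obj.V := T.obj.hom.hom.hom p₀
  let q₁ : T.obj.right.obj.obj.V := T.obj.hom.hom.hom (α.hom.hom.hom p₀)
  have htr : ∀ z : T.obj.right.obj.obj.V, ∃ g : G, g • q₀ = z := fun z =>
    BCat.exists_smul_eq_of_isConnectedObj _ T.obj.right.property q₀ z
  obtain ⟨β, hβ⟩ := exists_hom_of_stabilizer_le T.obj.right.obj T.obj.right.obj q₀ htr q₁
    (hgal q₀ q₁).le
  refine ⟨ObjectProperty.homMk
    { left := α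
      right := ObjectProperty.homMk β
      w := BCat.hom_eq_of_apply_eq T.obj.left.property p₀ ?_ }, rfl⟩
  change T.obj.hom.hom.hom (α.hom.hom.hom p₀) = β.hom.hom (T.obj.hom.hom.hom p₀)
  exact hβ.symm

/-- **Example 1.4 (ii), repaired form (PROVED):** for an object `(P, Q, ι)` of `E₀` whose `Q`-part is a
Galois object of `B(G)` (all stabilisers equal), `E₀ → P₀` induces a BIJECTION
`Aut_{E₀}(P, Q, ι) ⥲ Aut_{P₀}(P)`. (Injectivity for every object: `autBijective_injective`, seat d9;
the printed unconditional statement `AutBijective` fails at the non-Galois object `(A₃ ↷ {0,1,2},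
S₃ ↷ {0,1,2}, id)`, FLAG #10.) [cite: MochizukiFrdII2008, Ex. 1.4 (ii) p.13] -/
theorem autBijective_of_galois (T : ECat G D)
    (hgal : ∀ q q' : T.obj.right.obj.obj.V, MulAction.stabilizer G q = MulAction.stabilizer G q') :
    Function.Bijective fun a : Aut T => (toP₀ G D).mapIso a := by
  refine ⟨autBijective_injective D T, fun α => ?_⟩
  obtain ⟨a, ha⟩ := exists_hom_of_left_galois D T hgal α.hom
  obtain ⟨a', ha'⟩ := exists_hom_of_left_galois D T hgal α.inv
  have h₁ : a ≫ a' = 𝟙 T := hom_eq_of_left_eq D (by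
    change (toP₀ G D).map (a ≫ a') = (toP₀ G D).map (𝟙 T)
    rw [Functor.map_comp, ha, ha', CategoryTheory.Functor.map_id, Iso.hom_inv_id])
  have h₂ : a' ≫ a = 𝟙 T := hom_eq_of_left_eq D (by
    change (toP₀ G D).map (a' ≫ a) = (toP₀ G D).map (𝟙 T)
    rw [Functor.map_comp, ha, ha', CategoryTheory.Functor.map_id, Iso.inv_hom_id])
  refine ⟨⟨a, a', h₁, h₂⟩, Iso.ext ?_⟩
  exact ha

end NFLocCat

end Literature.AlgebraicGeometry.Frobenioids
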